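import Mathlib.NumberTheory.LSeries.RiemannZeta
import Mathlib.Analysis.SpecialFunctions.Gamma.Basic
import Literature.NumberTheory.LFunctions.FourthMomentDirichletPrimeModulus
import HarnessLib

/-!
# The fourth moment of Dirichlet `L`-functions to a GENERAL modulus
# (X. Wu, Math. Ann. 387 (2023), Theorem 1.1 and Theorem 1.2 — the shifted moment)

Topic `Literature/NumberTheory/LFunctions` (namespace `Literature.NumberTheory.LFunctions`,
sub-namespace `FourthMomentGeneralModulus`). STATEMENT LAYER (D-0014: sorry-free named `Prop`
facts; nothing deep asserted) typed for the cell `landau-siegel` (LANDAU–SIEGEL PROGRAMME, rung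
F-S3, §C literature harvest, paper row P-174 = r8-P30): the in-print record for the degree-`2 ⊗ 2`
(fourth-moment) family of primitive Dirichlet characters to ONE modulus WITHOUT any primality
assumption — the general-modulus sibling of `FourthMomentDirichletPrimeModulus.lean` (Young 2011,
BFKMM 2017, Zacharias 2019, BHKM 2020; prime modulus), whose `primitiveCount` (`φ*(q)`) and
`primitiveFourthMoment` it reuses.  It records that the single-modulus degree-4 power saving is
modulus-shape independent (`11/448` at `θ = 7/64`, the same number as Zacharias' prime-modulus
saving `zacharias_eta_eq`).  None of this is a statement about arXiv:2211.02515 or Siegel zeros.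

## What the source prints (X. Wu, *The fourth moment of Dirichlet `L`-functions at the central
## value*, Math. Ann. **387** (2023) 1199–1248 = arXiv:2008.13407; the JOURNAL version is arXiv
## **v5** (13 Oct 2022), read 2026-08-26 in its e-print TeX `fmq.tex` (l.207–311, l.323–335) — the
## held corpus text `paper:arxiv-2008.13407` is the 2020 v1, whose Theorem 1 still carries Young's
## exponent `−1/80 + θ/40` (p0004:L7–14); numbering `\numberwithin{theorem}{section}` (TeX l.130))

* §1 (TeX l.207–217): "For `q ≢ 2 (mod 4)`, Heath-Brown proved
  `(1/φ*(q)) Σ*_{χ (mod q)} |L(1/2,χ)|⁴ = (1/2π²) ∏_{p|q} (1−p⁻¹)³/(1+p⁻¹) (log q)⁴ + O(…)`, where the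
  sum is over all primitive characters modulo `q`, `φ*(q)` denotes the number of such primitive
  characters … Note that the condition `q ≢ 2 (mod 4)` is reasonable since there are no primitive
  characters modulo `q` if `q ≡ 2 (mod 4)`. … it is believed that, for any integer `q ≢ 2 (mod 4)`,
  (1.1) `(1/φ*(q)) Σ*_{χ (mod q)} |L(1/2,χ)|⁴ = ∏_{p|q} (1−p⁻¹)³/(1+p⁻¹) P₄(log q) + O(q^{−1/2+ε})` with
  `P₄(x)` being a computable absolute polynomial of degree `4`."
* **Theorem 1.1** (TeX l.230–236): "For any integer `q ≢ 2 (mod 4)`, we have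
  `(1/φ*(q)) Σ*_{χ (mod q)} |L(1/2,χ)|⁴ = ∏_{p|q} (1−p⁻¹)³/(1+p⁻¹) P₄(log q) + O(q^{−1/14 + (3/7)θ + ε})`
  for a certain computable absolute polynomial `P₄(x)`."  **Remark** (l.238–240): "With `θ = 7/64`,
  Theorem 1.1 gives an error term `q^{−11/448+ε}` for general moduli."  §1.3 Notation (l.323): "The
  symbol `θ` always denotes an admissible exponent for the Ramanujan–Petersson conjecture for Maass
  newforms, and the current best-known result is `θ = 7/64`" [Kim–Sarnak, cited there as Kim03].
* §1.2 (TeX l.272–292): "`M(α,β,γ,δ) = (2/φ*(q)) Σ⁺_{χ (mod q)} L(1/2+α,χ) L(1/2+β,χ) L(1/2+γ,χ̄)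
  L(1/2+δ,χ̄)`, where the symbol `+` indicates that the summation is over all primitive even
  characters.  `Z_q(α,β,γ,δ) = ζ_q(1+α+γ)ζ_q(1+α+δ)ζ_q(1+β+γ)ζ_q(1+β+δ)/ζ_q(2+α+β+γ+δ)` and (1.5)
  `X_{α,γ} = X_α X_γ`, `X_{α,β,γ,δ} = X_α X_β X_γ X_δ` with (1.6)
  `X_α = (q/π)^{−α} Γ((1/2−α+𝔞)/2)/Γ((1/2+α+𝔞)/2)` for `𝔞 = 0, 1`."  (`ζ_q(s) = Σ_{(n,q)=1} n^{−s}
  = ζ(s)∏_{p|q}(1−p^{−s})`, the paper's standing use, §6.1 Lemmas 6.1–6.2, TeX l.1020–1035, and the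
  printed definition in Gao–Wu–Zhao arXiv:2509.24690 p. 4: «ζ_q(s) the Euler product of ζ(s) with the
  primes dividing q removed»; `𝔞 = 0` for even, `1` for odd
  characters, l.347–352.)  **Conjecture 1.1** [CFK+05] (l.293–301): "For any integer `q ≢ 2 (mod 4)`,
  and with shifts `≪ (log q)^{−1}`, `𝔞 = 0`, we have (1.7) `M(α,β,γ,δ) = Z_q(α,β,γ,δ)
  + X_{α,β,γ,δ}Z_q(−γ,−δ,−α,−β) + X_{α,γ}Z_q(β,−γ,δ,−α) + X_{β,γ}Z_q(α,−γ,δ,−β) + X_{α,δ}Z_q(β,−δ,γ,−α)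
  + X_{β,δ}Z_q(α,−δ,γ,−β) + O(q^{−1/2+ε})`."  **Theorem 1.2** (l.304–306): "Conjecture 1.1 holds but
  with an error of size `O(q^{−1/14 + (3/7)θ + ε})`."  (l.308–311: the right-hand side is holomorphic
  in the shifts; taking the limit gives Theorem 1.1; by the maximum modulus principle it suffices to
  treat shifts separated so that `|α ± β| ≫ (log q)^{−1}`, etc.)

## Lean rendering / design choices

* `φ*(q)`, `(1/φ*(q)) Σ* |L(1/2,χ)|⁴` = the tree's `FourthMomentPrimeModulus.primitiveCount`,
  `primitiveFourthMoment` (defined there for every modulus; cited, not re-declared).  `L(s,χ)` =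
  Mathlib's `DirichletCharacter.LFunction`; `χ̄` = `χ⁻¹` (for Dirichlet characters the complex
  conjugate character is the inverse); "even" = `DirichletCharacter.Even` (`χ(−1) = 1`).
* `θ` is fixed at the printed admissible value `7/64` exactly as in the sister file (Young's
  `−5/512`, Zacharias' `11/448`): the exponent is written `−1/14 + 3·(7/64)/7 + ε` and
  `wu_exponent_eq` records `= −11/448 + ε` (the Remark).  `P₄` "computable absolute of degree 4" =
  `∃ P : Polynomial ℝ, P.natDegree = 4 ∧ …` bound BEFORE `ε` and `q` (absolute), as for BFKMM's
  Theorem 1.5 in the sister file; the `O`-constant depends on `ε` only.  "For any integer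
  `q ≢ 2 (mod 4)`" verbatim (`q % 4 ≠ 2`, all `q ≥ 1`; no threshold is printed and none is added to
  Theorem 1.1 — every term is finite, so small `q` are absorbed by `C`).
* Theorem 1.2 (an asymptotic identity of holomorphic functions of the shifts) is rendered POINTWISE:
  for every implied constant `c` of "shifts `≪ (log q)^{−1}`" and every `ε > 0` there are `q₀`, `C`
  with `|M − (six terms)| ≤ C q^{−11/448+ε}` for all `q ≥ q₀`, `q ≢ 2 (mod 4)`, and all shifts of
  modulus `≤ c/log q` at which the six terms are individually finite, i.e. off the removable polar
  set `α+γ, α+δ, β+γ, β+δ, α−β, γ−δ = 0` (the separation the source itself reduces to, l.310–311;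
  Mathlib's `riemannZeta` carries a junk value at `1`).  The threshold `q₀ = q₀(c)` only keeps the
  shift box inside the region where `ζ_q(2+…) ≠ 0`; it weakens nothing printed (an `O`-statement
  in `q`).  This is weaker than the printed identity only on the removable singular set.
* Conjecture 1.1 itself (error `q^{−1/2+ε}`) is an open conjecture and is NOT declared (conjectures
  are not Literature facts); only its six-term main term is, as the FUNCTION `cfkrsMainTerm`.
* NOT typed (index only): Heath-Brown's and Soundararajan's leading-term results (secondary
  displays here); Theorem 4.1 (the `E_{M,N}` bound) and the `𝒟_q`-function theory of §§3–8; the odd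
  case (`𝔞 = 1`, "similar", l.302) — `xFactor` carries the parameter `𝔞` so that it can be stated
  later without new vocabulary.

PROVED here (bookkeeping only): `wu_exponent_eq` (`−1/14 + 3(7/64)/7 = −11/448`),
`wu_exponent_eq_neg_zacharias_eta` (the general-modulus saving equals the prime-modulus saving of
`zacharias_eta_eq`), `eulerFactor_one`, `eulerFactor_prime`, `eulerFactor_pos`, `zetaQ_one_left`
(`ζ_1 = ζ`), `zQ_swap12`/`zQ_swap34`/`zQ_swap13_24` (the printed transposition symmetries of
`Z_q`), `wu2023_theorem11.primeCase` (Theorem 1.1 specialised to prime `q ≥ 3`, where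
`∏_{p|q} = (1−q⁻¹)³/(1+q⁻¹)`).
Nothing else is claimed.  Harvest tag: E*-len (RECORD, general modulus: saving `11/448`; no length
or proportion statement); what it would need to bite: a degree-4 numerator at one modulus with a
twist/mollifier of length approaching `θ* = 1` — the printed technology buys `≈ q^{0.0027}`
(Zacharias) to `q^{1/22}` (Gao–Wu–Zhao 2025), cf. the r8 RECORDS TABLE of the cell.

## References

* [WuXiaosheng2023FourthMoment] Theorem 1.1, Remark, §1.2 (M, Z_q, X_α, Conjecture 1.1),
  Theorem 1.2, §1.3 (θ) — arXiv:2008.13407v5 TeX l.207–335.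
* Tree: `FourthMomentDirichletPrimeModulus.lean` ([Young2011], [Zacharias2019], …) for `φ*(q)` and
  the moment; `zacharias_eta_eq` there.
-/

noncomputable section

open Finset Complex

namespace Literature.NumberTheory.LFunctions

namespace FourthMomentGeneralModulus

open FourthMomentPrimeModulus

/-! ### The objects of §1 -/

/-- The arithmetic factor `∏_{p ∣ q} (1 − p⁻¹)³/(1 + p⁻¹)` of (1.1)/(1.3) (`= 1` for `q = 1`).
[cite: WuXiaosheng2023FourthMoment, Theorem 1.1 (1.3)] -/
def eulerFactor (q : ℕ) : ℝ :=
  ∏ p ∈ q.primeFactors, (1 - (p : ℝ)⁻¹) ^ 3 / (1 + (p : ℝ)⁻¹)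

/-- `ζ_q(s) = Σ_{(n,q)=1} n^{−s} = ζ(s) ∏_{p ∣ q} (1 − p^{−s})`: the Riemann zeta function with the
Euler factors at the primes dividing `q` removed (Mathlib's `riemannZeta`, junk value at `s = 1`).
[cite: WuXiaosheng2023FourthMoment, §1.2 (Z_q); ζ_q as used in §6.1, Lemmas 6.1–6.2] -/
def zetaQ (q : ℕ) (s : ℂ) : ℂ :=
  riemannZeta s * ∏ p ∈ q.primeFactors, (1 - (p : ℂ) ^ (-s))

/-- `Z_q(α,β,γ,δ) = ζ_q(1+α+γ) ζ_q(1+α+δ) ζ_q(1+β+γ) ζ_q(1+β+δ) / ζ_q(2+α+β+γ+δ)`.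
[cite: WuXiaosheng2023FourthMoment, §1.2 (definition of Z_q)] -/
def zQ (q : ℕ) (α β γ δ : ℂ) : ℂ :=
  zetaQ q (1 + α + γ) * zetaQ q (1 + α + δ) * zetaQ q (1 + β + γ) * zetaQ q (1 + β + δ) /
    zetaQ q (2 + α + β + γ + δ)

/-- `X_α = (q/π)^{−α} Γ((1/2 − α + 𝔞)/2) / Γ((1/2 + α + 𝔞)/2)` (1.6), `𝔞 = 0` (even characters) or
`1` (odd). [cite: WuXiaosheng2023FourthMoment, §1.2 (1.6)] -/
def xFactor (q : ℕ) (𝔞 : ℕ) (α : ℂ) : ℂ :=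
  ((q : ℂ) / (Real.pi : ℂ)) ^ (-α) * Gamma ((1 / 2 - α + 𝔞) / 2) / Gamma ((1 / 2 + α + 𝔞) / 2)

open scoped Classical in
/-- The shifted fourth moment over primitive EVEN characters,
`M(α,β,γ,δ) = (2/φ*(q)) Σ⁺_{χ (mod q)} L(1/2+α,χ) L(1/2+β,χ) L(1/2+γ,χ̄) L(1/2+δ,χ̄)` (`χ̄ = χ⁻¹`).
[cite: WuXiaosheng2023FourthMoment, §1.2 (definition of M(α,β,γ,δ))] -/
def shiftedMoment (q : ℕ) [NeZero q] (α β γ δ : ℂ) : ℂ :=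
  2 / (primitiveCount q : ℂ) *
    ∑ χ : DirichletCharacter ℂ q with (χ.IsPrimitive ∧ χ.Even),
      χ.LFunction (1 / 2 + α) * χ.LFunction (1 / 2 + β) *
        χ⁻¹.LFunction (1 / 2 + γ) * χ⁻¹.LFunction (1 / 2 + δ)

/-- The six-term right-hand side of (1.7) (Conrey–Farmer–Keating–Rubinstein–Snaith), `𝔞 = 0`:
`Z_q(α,β,γ,δ) + X_{α,β,γ,δ} Z_q(−γ,−δ,−α,−β) + X_{α,γ} Z_q(β,−γ,δ,−α) + X_{β,γ} Z_q(α,−γ,δ,−β)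
+ X_{α,δ} Z_q(β,−δ,γ,−α) + X_{β,δ} Z_q(α,−δ,γ,−β)` with `X_{α,γ} = X_α X_γ`,
`X_{α,β,γ,δ} = X_α X_β X_γ X_δ` (1.5).  A FUNCTION of the shifts; Conjecture 1.1 (that `M` equals it
up to `O(q^{−1/2+ε})`) is open and is not declared here.
[cite: WuXiaosheng2023FourthMoment, §1.2 (1.5) and Conjecture 1.1 (1.7), the main term] -/
def cfkrsMainTerm (q : ℕ) (α β γ δ : ℂ) : ℂ :=
  zQ q α β γ δ +
    xFactor q 0 α * xFactor q 0 β * xFactor q 0 γ * xFactor q 0 δ * zQ q (-γ) (-δ) (-α) (-β) +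
    xFactor q 0 α * xFactor q 0 γ * zQ q β (-γ) δ (-α) +
    xFactor q 0 β * xFactor q 0 γ * zQ q α (-γ) δ (-β) +
    xFactor q 0 α * xFactor q 0 δ * zQ q β (-δ) γ (-α) +
    xFactor q 0 β * xFactor q 0 δ * zQ q α (-δ) γ (-β)

/-- The shifts at which every `ζ_q(1 + ·)` in the six terms of (1.7) is off its pole: `α+γ`, `α+δ`,
`β+γ`, `β+δ`, `α−β`, `γ−δ` all non-zero — the separation "`|α ± β| ≫ (log q)^{−1}`, etc." to which
the source reduces the proof (the singularities of the individual terms are removable in the sum).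
[cite: WuXiaosheng2023FourthMoment, §1.2 (paragraph after Theorem 1.2)] -/
def ShiftsOffPoles (α β γ δ : ℂ) : Prop :=
  α + γ ≠ 0 ∧ α + δ ≠ 0 ∧ β + γ ≠ 0 ∧ β + δ ≠ 0 ∧ α ≠ β ∧ γ ≠ δ

end FourthMomentGeneralModulus

open FourthMomentPrimeModulus FourthMomentGeneralModulus

/-! ### The named facts (statement layer; theorems in print, not proved here) -/

/-- **X. Wu 2023, Theorem 1.1** (as printed in the journal version, arXiv:2008.13407v5): "For any
integer `q ≢ 2 (mod 4)`, we have
`(1/φ*(q)) Σ*_{χ (mod q)} |L(1/2,χ)|⁴ = ∏_{p|q} (1−p⁻¹)³/(1+p⁻¹) · P₄(log q) + O(q^{−1/14+(3/7)θ+ε})`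
for a certain computable absolute polynomial `P₄(x)`" (of degree `4`, (1.1)), `θ` an admissible
Ramanujan–Petersson exponent for Maass newforms, "one may take `θ = 7/64`" — Remark: error
`q^{−11/448+ε}`.  Rendered at `θ = 7/64`: there is `P ∈ ℝ[X]` of degree `4` (absolute) such that for
every `ε > 0` there is `C` with `|moment − eulerFactor(q)·P(log q)| ≤ C q^{−1/14+3(7/64)/7+ε}` for all
`q ≥ 1`, `q ≢ 2 (mod 4)`.  Status: theorem-in-print; named fact, not proved here.
[cite: WuXiaosheng2023FourthMoment, Theorem 1.1 and Remark] -/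
def wu2023_theorem11 : Prop :=
  ∃ P : Polynomial ℝ, P.natDegree = 4 ∧ ∀ ε : ℝ, 0 < ε → ∃ C : ℝ, ∀ (q : ℕ) [NeZero q], q % 4 ≠ 2 →
    |primitiveFourthMoment q - eulerFactor q * P.eval (Real.log q)| ≤
      C * (q : ℝ) ^ (-(1 : ℝ) / 14 + 3 * (7 / 64) / 7 + ε)

/-- **X. Wu 2023, Theorem 1.2** (the shifted fourth moment — a THEOREM in print; as printed it
says that the six-term formula (1.7) of Conrey–Farmer–Keating–Rubinstein–Snaith "holds but with an
error of size `O(q^{−1/14+(3/7)θ+ε})`"), i.e. for any integer `q ≢ 2 (mod 4)` and shifts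
`≪ (log q)^{−1}` (`𝔞 = 0`), `M(α,β,γ,δ) = [the six terms (1.7)] + O(q^{−1/14+(3/7)θ+ε})`.  Rendered
pointwise at `θ = 7/64` (see the module docstring): for every `c > 0` and `ε > 0` there are `q₀` and
`C` such that for all `q ≥ q₀` with `q ≢ 2 (mod 4)` and all shifts with `|α|,|β|,|γ|,|δ| ≤ c/log q`
off the removable polar set (`ShiftsOffPoles`),
`|M(α,β,γ,δ) − cfkrsMainTerm| ≤ C q^{−1/14+3(7/64)/7+ε}`.  The `q^{−1/2+ε}` strengthening (1.7) itself
is NOT asserted anywhere in this file.  Status: theorem-in-print; named fact, not proved here.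
[cite: WuXiaosheng2023FourthMoment, Theorem 1.2 (with (1.7) and §1.3, θ = 7/64)] -/
def wu2023_theorem12 : Prop :=
  ∀ c : ℝ, 0 < c → ∀ ε : ℝ, 0 < ε → ∃ q₀ : ℕ, ∃ C : ℝ, ∀ (q : ℕ) [NeZero q], q₀ ≤ q → q % 4 ≠ 2 →
    ∀ α β γ δ : ℂ, ‖α‖ ≤ c / Real.log q → ‖β‖ ≤ c / Real.log q → ‖γ‖ ≤ c / Real.log q →
      ‖δ‖ ≤ c / Real.log q → ShiftsOffPoles α β γ δ →
        ‖shiftedMoment q α β γ δ - cfkrsMainTerm q α β γ δ‖ ≤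
          C * (q : ℝ) ^ (-(1 : ℝ) / 14 + 3 * (7 / 64) / 7 + ε)

/-! ### Bookkeeping (proved) -/

/-- The Remark: `−1/14 + (3/7)·(7/64) = −11/448`. [cite: WuXiaosheng2023FourthMoment, Remark after
Theorem 1.1] -/
theorem wu_exponent_eq : -(1 : ℝ) / 14 + 3 * (7 / 64) / 7 = -11 / 448 := by norm_num

/-- The general-modulus saving is the SAME number as Zacharias' prime-modulus saving
`η = 1/14 − 3θ/7 = 11/448` (`zacharias_eta_eq` in the sister file).
[cite: WuXiaosheng2023FourthMoment, Remark after Theorem 1.1] -/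
theorem wu_exponent_eq_neg_zacharias_eta :
    -(1 : ℝ) / 14 + 3 * (7 / 64) / 7 = -((1 : ℝ) / 14 - 3 * (7 / 64) / 7) := by ring

namespace FourthMomentGeneralModulus

/-- `eulerFactor 1 = 1` (empty product). [cite: WuXiaosheng2023FourthMoment, Theorem 1.1 (1.3)] -/
theorem eulerFactor_one : eulerFactor 1 = 1 := by
  simp [eulerFactor]

/-- For a prime `p`: `∏_{ℓ ∣ p} (1−ℓ⁻¹)³/(1+ℓ⁻¹) = (1−p⁻¹)³/(1+p⁻¹)`.
[cite: WuXiaosheng2023FourthMoment, Theorem 1.1 (1.3)] -/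
theorem eulerFactor_prime {p : ℕ} (hp : p.Prime) :
    eulerFactor p = (1 - (p : ℝ)⁻¹) ^ 3 / (1 + (p : ℝ)⁻¹) := by
  simp [eulerFactor, hp.primeFactors]

/-- The arithmetic factor is positive. [cite: WuXiaosheng2023FourthMoment, Theorem 1.1 (1.3)] -/
theorem eulerFactor_pos (q : ℕ) : 0 < eulerFactor q := by
  unfold eulerFactor
  refine prod_pos fun p hp => ?_
  have hp2 : (2 : ℝ) ≤ p := by exact_mod_cast (Nat.prime_of_mem_primeFactors hp).two_le
  have hinv : (p : ℝ)⁻¹ ≤ 1 / 2 := by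
    rw [inv_eq_one_div]
    exact one_div_le_one_div_of_le (by norm_num) hp2
  have h1 : 0 < 1 - (p : ℝ)⁻¹ := by linarith
  have h2 : 0 < 1 + (p : ℝ)⁻¹ := by positivity
  positivity

/-- `ζ_1 = ζ` (no Euler factor removed). [cite: WuXiaosheng2023FourthMoment, §1.2 (Z_q)] -/
theorem zetaQ_one_left (s : ℂ) : zetaQ 1 s = riemannZeta s := by
  simp [zetaQ]

/-- `Z_q` is invariant under `α ↔ β`. [cite: WuXiaosheng2023FourthMoment, §1.2 (symmetries of Z_q)] -/
theorem zQ_swap12 (q : ℕ) (α β γ δ : ℂ) : zQ q β α γ δ = zQ q α β γ δ := by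
  unfold zQ
  have h : (2 : ℂ) + β + α + γ + δ = 2 + α + β + γ + δ := by ring
  rw [h]
  ring

/-- `Z_q` is invariant under `γ ↔ δ`. [cite: WuXiaosheng2023FourthMoment, §1.2 (symmetries of Z_q)] -/
theorem zQ_swap34 (q : ℕ) (α β γ δ : ℂ) : zQ q α β δ γ = zQ q α β γ δ := by
  unfold zQ
  have h : (2 : ℂ) + α + β + δ + γ = 2 + α + β + γ + δ := by ring
  rw [h]
  ring

/-- `Z_q` is invariant under the simultaneous transpositions `α ↔ γ`, `β ↔ δ` ("e.g.
`Z_q(−γ,−δ,−α,−β) = Z_q(−α,−β,−γ,−δ)`").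
[cite: WuXiaosheng2023FourthMoment, §1.2 (symmetries of Z_q)] -/
theorem zQ_swap13_24 (q : ℕ) (α β γ δ : ℂ) : zQ q γ δ α β = zQ q α β γ δ := by
  unfold zQ
  have h1 : (1 : ℂ) + γ + α = 1 + α + γ := by ring
  have h2 : (1 : ℂ) + γ + β = 1 + β + γ := by ring
  have h3 : (1 : ℂ) + δ + α = 1 + α + δ := by ring
  have h4 : (1 : ℂ) + δ + β = 1 + β + δ := by ring
  have h5 : (2 : ℂ) + γ + δ + α + β = 2 + α + β + γ + δ := by ring
  rw [h1, h2, h3, h4, h5]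
  ring

end FourthMomentGeneralModulus

/-- **Theorem 1.1 at a prime modulus** (bookkeeping): for `q = p ≥ 3` prime the hypothesis
`p ≢ 2 (mod 4)` holds and the arithmetic factor is `(1−p⁻¹)³/(1+p⁻¹)`, so the named fact gives
`|moment − (1−p⁻¹)³/(1+p⁻¹)·P(log p)| ≤ C p^{−11/448+ε}` — the shape comparable with Young's prime
case in the sister file. [cite: WuXiaosheng2023FourthMoment, Theorem 1.1 and Remark] -/
theorem wu2023_theorem11.primeCase (h : wu2023_theorem11) :
    ∃ P : Polynomial ℝ, P.natDegree = 4 ∧ ∀ ε : ℝ, 0 < ε → ∃ C : ℝ, ∀ (p : ℕ) [NeZero p],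
      p.Prime → 3 ≤ p →
        |primitiveFourthMoment p - (1 - (p : ℝ)⁻¹) ^ 3 / (1 + (p : ℝ)⁻¹) * P.eval (Real.log p)| ≤
          C * (p : ℝ) ^ (-(11 : ℝ) / 448 + ε) := by
  obtain ⟨P, hP, hmain⟩ := h
  refine ⟨P, hP, fun ε hε => ?_⟩
  obtain ⟨C, hC⟩ := hmain ε hε
  refine ⟨C, fun p _ hp hp3 => ?_⟩
  have hmod : p % 4 ≠ 2 := by
    intro h2
    have h22 : 2 ∣ p := by omega
    have := (Nat.prime_dvd_prime_iff_eq Nat.prime_two hp).mp h22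
    omega
  have key := hC p hmod
  rw [eulerFactor_prime hp] at key
  have hexp : -(1 : ℝ) / 14 + 3 * (7 / 64) / 7 + ε = -(11 : ℝ) / 448 + ε := by norm_num
  rwa [hexp] at key

end Literature.NumberTheory.LFunctions

end
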